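import Mathlib
import Summits.Ventures.PercRepro2.SwOutAll
import Summits.Ventures.PercRepro2.SwOutSeriesDefs
import Summits.Ventures.PercRepro2.SwOutLeafThm
import Summits.Ventures.PercRepro2.SwOutLoop

/-!
# Parking a loop inside an outside class, part 2: edge sets, counts and THEOREM P (blind cell
PercRepro2, night-4 g10, 2026-08-25; proofs/NIGHT4-G10.md §2, Remark (ii′))

`redEdges_parkLoop`: the red edges of `C_R(h)` in `G` are those of the parked graph tagged by the
loop at its vertex when the loop is red; `card_filter_loop_eq`: the configurations with a prescribed
colour of the loop are in bijection with the parked class; **`card_le_of_loop`** (THEOREM P): the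
rigid counting inequalities of the parked class, for every up-set, give those of the class.
-/

namespace Summit.Ventures.PercRepro2

namespace LocRows

open Hull

variable {V : Type*} {E : Type*} [Fintype E] [DecidableEq E]

open scoped Classical

variable {ends : E → Sym2 V} {l p : V} {e₁ : E}

section LoopThm

variable (hs : ends e₁ = s(p, p))
include hs

/-- **The red edge set under parking** (for a colouring whose red cluster of `h` avoids `l`). -/
theorem redEdges_parkLoop {h : V} {ω : Config E} (hlω : l ∉ cluster ends ω h) (b : Bool) :
    redEdges ends ω h =
      if ω e₁ = true then
        tagSub (parkLoop ends l e₁) h e₁ p (redEdges (parkLoop ends l e₁) (Function.update ω e₁ b) h)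
      else redEdges (parkLoop ends l e₁) (Function.update ω e₁ b) h := by
  set ends' := parkLoop ends l e₁ with hends'
  set ω' := Function.update ω e₁ b with hω'
  have hC : cluster ends' ω' h = cluster ends ω h := cluster_parkLoop_update hs ω b h
  have hclu : cluster ends' ω' h = insert h {x | ∃ e ∈ redEdges ends' ω' h, x ∈ ends' e} :=
    cluster_eq_insert_ends_redEdges ω' h
  have hL1 : e₁ ∈ within ends (cluster ends ω h) ↔ p ∈ cluster ends ω h := by
    rw [within_iff_of_ends hs]; exact ⟨fun h' => h'.1, fun h' => ⟨h', h'⟩⟩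
  have he₁R : e₁ ∉ redEdges ends' ω' h := by
    rintro ⟨_, hw⟩
    rw [within_iff_of_ends (parkLoop_apply_e₁ (ends := ends) (l := l) (e₁ := e₁)), hC] at hw
    exact hlω hw.1
  have hother : ∀ e, e ≠ e₁ → (e ∈ redEdges ends ω h ↔ e ∈ redEdges ends' ω' h) := by
    intro e he₁
    rw [mem_redEdges, mem_redEdges, hC]
    have hω'e : ω' e = ω e := Function.update_of_ne he₁ b ω
    have hends'e : ends' e = ends e := parkLoop_apply_of_ne he₁
    rw [hω'e]
    constructor
    · rintro ⟨he, x, hx, y, hy, hxy⟩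
      exact ⟨he, x, hx, y, hy, by rw [hends'e]; exact hxy⟩
    · rintro ⟨he, x, hx, y, hy, hxy⟩
      rw [hends'e] at hxy
      exact ⟨he, x, hx, y, hy, hxy⟩
  split_ifs with h₁
  · ext e
    rw [mem_tagSub_iff]
    by_cases he₁ : e = e₁
    · subst e
      rw [mem_redEdges, hL1]
      constructor
      · rintro ⟨_, hp⟩
        exact Or.inr ⟨rfl, by rw [← hclu, hC]; exact hp⟩
      · rintro (h' | ⟨_, hp⟩)
        · exact absurd h' he₁R
        · rw [← hclu, hC] at hp
          exact ⟨h₁, hp⟩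
    · simp only [he₁, false_and, or_false]
      exact hother e he₁
  · ext e
    by_cases he₁ : e = e₁
    · subst e
      simp only [mem_redEdges, h₁, Bool.false_eq_true, false_and, false_iff]
      exact he₁R
    · exact hother e he₁

/-- **The blue edge set under parking.** -/
theorem blueEdges_parkLoop {h : V} {ζ : Config E} (hlζ : l ∉ cluster ends (blue ζ) h) :
    blueEdges ends ζ h =
      if ζ e₁ = false then
        tagSub (parkLoop ends l e₁) h e₁ p
          (blueEdges (parkLoop ends l e₁) (Function.update ζ e₁ false) h)
      else blueEdges (parkLoop ends l e₁) (Function.update ζ e₁ false) h := by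
  unfold blueEdges
  rw [blue_update]
  have := redEdges_parkLoop hs (ω := blue ζ) hlζ true
  rw [this]
  have hb : (blue ζ e₁ = true) = (ζ e₁ = false) := by simp [blue]
  simp only [hb]
  rfl

/-- The configurations with a prescribed colour of the loop are in bijection with the parked class,
for predicates corresponding under `ζ ↦ ζ[e₁ ↦ false]`. -/
theorem card_filter_loop_eq {U : Set V} {ξ : Config E} {h o : V} (hl : l ∉ U) (hp : p ∈ U)
    (c : Bool) (P : Config E → Prop) (P' : Config E → Prop)
    (hPP : ∀ ζ ∈ swOutSide ends l h o U ξ, ζ e₁ = c → (P ζ ↔ P' (Function.update ζ e₁ false))) :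
    ((swOutSide ends l h o U ξ).filter fun ζ => ζ e₁ = c ∧ P ζ).card =
      ((swOutSide (parkLoop ends l e₁) l h o U
        (Function.update ξ e₁ false)).filter fun ζ' => P' ζ').card := by
  refine Finset.card_bij (fun ζ _ => Function.update ζ e₁ false) ?_ ?_ ?_
  · intro ζ hζ
    rw [Finset.mem_filter] at hζ ⊢
    obtain ⟨hζ, h₁, hP⟩ := hζ
    exact ⟨(mem_swOutSide_parkLoop_iff hs hl hp).1 hζ, (hPP ζ hζ h₁).1 hP⟩
  · intro ζ₁ hζ₁ ζ₂ hζ₂ heq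
    rw [Finset.mem_filter] at hζ₁ hζ₂
    funext e
    by_cases he₁ : e = e₁
    · subst e; rw [hζ₁.2.1, hζ₂.2.1]
    · have := congrFun heq e
      rwa [Function.update_of_ne he₁, Function.update_of_ne he₁] at this
  · intro ζ' hζ'
    rw [Finset.mem_filter] at hζ'
    have hmem := (mem_swOutSide.1 hζ'.1).2
    rw [mem_outClass] at hmem
    have hpin : ζ' e₁ = false := by
      have := hmem.1 e₁ (by rw [mem_touches_parkLoop_iff hl]; exact fun h' => h'.2 rfl)
      rw [this]; simp
    refine ⟨Function.update ζ' e₁ c, ?_, ?_⟩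
    · have h₁ : Function.update ζ' e₁ c e₁ = c := by simp
      have hback : Function.update (Function.update ζ' e₁ c) e₁ false = ζ' := by
        rw [Function.update_idem]
        exact Function.update_eq_self_iff.2 hpin.symm
      have hmem' : Function.update ζ' e₁ c ∈ swOutSide ends l h o U ξ := by
        rw [mem_swOutSide_parkLoop_iff hs hl hp, hback]; exact hζ'.1
      rw [Finset.mem_filter]
      refine ⟨hmem', h₁, ?_⟩
      rw [hPP _ hmem' h₁, hback]
      exact hζ'.2
    · rw [Function.update_idem]
      exact Function.update_eq_self_iff.2 hpin.symm

/-- **THEOREM P (parking a loop inside an outside class)**: the rigid counting inequalities of the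
parked class `(G', U, ξ[e₁ ↦ false])`, for every up-set, give those of the class `(G, U, ξ)`. -/
theorem card_le_of_loop {U : Set V} {ξ : Config E} {h o : V} (hl : l ∉ U) (hp : p ∈ U)
    (ih : ∀ 𝓔 : Set (Set E), IsUpperSet 𝓔 →
      ((swOutSide (parkLoop ends l e₁) l h o U (Function.update ξ e₁ false)).filter fun ζ' =>
            redEdges (parkLoop ends l e₁) ζ' h ∈ 𝓔).card ≤
        ((swOutSide (parkLoop ends l e₁) l h o U (Function.update ξ e₁ false)).filter fun ζ' =>
            blueEdges (parkLoop ends l e₁) ζ' h ∈ 𝓔).card)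
    {𝓔 : Set (Set E)} (h𝓔 : IsUpperSet 𝓔) :
    ((swOutSide ends l h o U ξ).filter fun ζ => redEdges ends ζ h ∈ 𝓔).card ≤
      ((swOutSide ends l h o U ξ).filter fun ζ => blueEdges ends ζ h ∈ 𝓔).card := by
  -- on the class `l` lies in neither cluster of `h`
  have hlT : ∀ ζ ∈ swOutSide ends l h o U ξ, l ∉ cluster ends ζ h := fun ζ hζ h' =>
    hl ((mem_outClass.1 (mem_swOutSide.1 hζ).2).2 (Or.inl h'))
  have hlTp : ∀ ζ ∈ swOutSide ends l h o U ξ, l ∉ cluster ends (blue ζ) h := fun ζ hζ h' =>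
    hl ((mem_outClass.1 (mem_swOutSide.1 hζ).2).2 (Or.inr h'))
  rw [card_filter_split_leaf (e₁ := e₁) (swOutSide ends l h o U ξ)
      (fun ζ => redEdges ends ζ h ∈ 𝓔),
    card_filter_split_leaf (e₁ := e₁) (swOutSide ends l h o U ξ)
      (fun ζ => blueEdges ends ζ h ∈ 𝓔)]
  have hrT := card_filter_loop_eq hs (U := U) (ξ := ξ) (h := h) (o := o) hl hp true (fun ζ => redEdges ends ζ h ∈ 𝓔)
    (fun ζ' => redEdges (parkLoop ends l e₁) ζ' h ∈ tagSub (parkLoop ends l e₁) h e₁ p ⁻¹' 𝓔)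
    (fun ζ hζ h₁ => by
      rw [Set.mem_preimage, redEdges_parkLoop hs (hlT ζ hζ) false, if_pos h₁])
  have hrF := card_filter_loop_eq hs (U := U) (ξ := ξ) (h := h) (o := o) hl hp false (fun ζ => redEdges ends ζ h ∈ 𝓔)
    (fun ζ' => redEdges (parkLoop ends l e₁) ζ' h ∈ 𝓔)
    (fun ζ hζ h₁ => by
      rw [redEdges_parkLoop hs (hlT ζ hζ) false, if_neg (by rw [h₁]; decide)])
  have hbT := card_filter_loop_eq hs (U := U) (ξ := ξ) (h := h) (o := o) hl hp true (fun ζ => blueEdges ends ζ h ∈ 𝓔)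
    (fun ζ' => blueEdges (parkLoop ends l e₁) ζ' h ∈ 𝓔)
    (fun ζ hζ h₁ => by rw [blueEdges_parkLoop hs (hlTp ζ hζ), if_neg (by rw [h₁]; decide)])
  have hbF := card_filter_loop_eq hs (U := U) (ξ := ξ) (h := h) (o := o) hl hp false (fun ζ => blueEdges ends ζ h ∈ 𝓔)
    (fun ζ' => blueEdges (parkLoop ends l e₁) ζ' h ∈ tagSub (parkLoop ends l e₁) h e₁ p ⁻¹' 𝓔)
    (fun ζ hζ h₁ => by rw [Set.mem_preimage, blueEdges_parkLoop hs (hlTp ζ hζ), if_pos h₁])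
  rw [hrT, hrF, hbT, hbF]
  have h1 := ih _ (isUpperSet_preimage_tagSub (ends := parkLoop ends l e₁) (h := h) (e₀ := e₁)
    (p := p) h𝓔)
  have h2 := ih _ h𝓔
  omega

end LoopThm

end LocRows

end Summit.Ventures.PercRepro2
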